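import Summits.BirchSwinnertonDyer.BirchSwinnertonDyer.Theses.DerivedKatoValuationDoor
import Summits.BirchSwinnertonDyer.BirchSwinnertonDyer.Theorems.DerivedKatoValuationDoorFineLengthLeOneOfAnalyticRankTwoStubIntegralH1RankLeTwoOfDictionary
import Summits.BirchSwinnertonDyer.Rank1Residual.Additive.KatoDescentGlobalKummerTamagawa
import Summits.BirchSwinnertonDyer.BirchSwinnertonDyer.Theorems.CongruentShaFreeCutKatoKummerLogTorsion
import Literature.NumberTheory.EllipticCurves.CanonicalPAdicHeightJunkSigmaProofs
import Literature.NumberTheory.EllipticCurves.IntegralH1LocalisationRankDictionary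
import HarnessLib

/-!
# ε from ONE rational point of infinite order — the rider `CrisAtDoorPrimes` (stmt-BirchSwinnertonDyer-23148)
# follows from the route's residual `PointsTwo` (stmt-BirchSwinnertonDyer-23026); line `birth` on the (β) crux
# S2 `IntegralH1RankLeTwoOfAnalyticRankTwo` (stmt-BirchSwinnertonDyer-23752), LEAD bsd-line-dkd-p1 g3

The birth skeleton of S2 (`Cruxes/IntegralH1RankLeTwoOfAnalyticRankTwo/Lines/birth.lean`, registered) reads
S2 ⟸ `stub_lemme239` (print) ∧ `stub_selCapTwoAtDoorOfAnalyticRankTwo` (N1∣_door, open) ∧ `stub_crisAtDoorPrimes`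
(ε = the route item `CrisAtDoorPrimes`: at a door prime of an analytic-rank-two curve some INTEGRAL class
`x ∈ H¹(ℤ[1/p], T_pE)` localises at `p` to a Kummer class of NON-ZERO logarithm).  The old birth line of the
parent crux displayed the implication «one rational point of infinite order ⇒ ε at EVERY prime» as a PRINT
statement `LocPOfPoint`, noting that «the one tree ingredient still missing is the `T_p`-adic Kummer CLASS of a
point as an element of `H1 (tateRep W p) ⊤`».  That ingredient is in the tree now
(`GlobalKummer.exists_pow_smul_kummerTate_mem_integralH1_hasLocPKummerLog`: an additive `κ_∞ : E(ℚ) → H¹(Γ_ℚ, T_pE)`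
with `p^c • κ_∞(P) ∈ H¹(ℤ[1/p], T_pE)` and `HasLocPKummerLog W p (p^c • κ_∞ P) (log_ω(p^c • P))`), and the kernel
of `log_ω` on `E(ℚ_p)` is the torsion (`isOfFinAddOrder_of_padicLogLocal_eq_zero`).  Hence, as THEOREMS
(no named fact, no sorry):

* §1 `exists_integral_hasLocPKummerLog_ne_zero_of_not_isOfFinAddOrder` — `LocPOfPoint` PROVED: for `W/ℚ`
  globally minimal, EVERY prime `p` and a rational point `P` of infinite order, some integral class has a Kummer
  localisation of non-zero logarithm (`ε_p = 1`); `…_of_mordellWeilRank_ne_zero` — the same from `rank E(ℚ) ≠ 0`.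
* §2 `crisAtDoorPrimes_of_forall_rankPos` — ε ⟸ «`a = 2 ⇒ 1 ≤ rank E(ℚ)`»; `crisAtDoorPrimes_of_pointsTwo` —
  **`PointsTwo → CrisAtDoorPrimes`**: the rider 23148 is implied by the route's own residual binder 23026 (the
  door triple is not used: ε holds at every prime of a positive-rank curve).
* §3 `integralH1RankLeTwoOfAnalyticRankTwo_of_lemme239_of_selCap_of_pointsTwo` — the crux S2 BY NAME from
  {Perrin-Riou's dictionary fact (print), N1∣_door (open), `PointsTwo` (the route's declared residual)}: inside
  the route (whose `closes` already consumes `PointsTwo`) the conjecture-grade content of S2 beyond print is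
  exactly N1∣_door «`a = 2 ⇒ s_p ≤ 2` at door primes».

HONEST FRAMING.  Nothing here proves ε without a point (the phantom cell `a = 2 ∧ r = 0` is untouched), N1∣_door,
S2 or BSD; §3 is a conditional reduction (the gate records `conditional-result` for the named fact).  Helper for
stmt-BirchSwinnertonDyer-23752 (`--supports`); closes nothing.

References: [cite: BlochKato1990, Def. 3.10 and Ex. 3.11] (the Kummer image is `H¹_f(ℚ_p, V)`, `log` on it);
[cite: Kato2004Asterisque, §14.1 (p. 235) and §8.2 (pp. 180–181)] (`E(ℚ) ⊗ ℤ_p → H¹(ℤ[1/p], T)`);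
[cite: SilvermanAEC2009, IV.6.4 and VII.6.3] (kernel of the formal logarithm = torsion);
[cite: PerrinRiou1993AIF, Lemme 2.3.9 (p. 967) and 2.3.8 b) (p. 966)] (ε automatic off the phantom cell);
[cite: KuriharaPollack2007, §1.4 Lemma 1.4].
-/

set_option linter.dupNamespace false
set_option autoImplicit false

noncomputable section

open scoped Classical

namespace Summit.BirchSwinnertonDyer.BirchSwinnertonDyer.Theorems.DerivedKatoValuationDoor

open Field
open Literature Literature.NumberTheory.GaloisRepresentations
open Literature.NumberTheory.EllipticCurves Literature.NumberTheory.EllipticCurves.Kato2004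
open Literature.NumberTheory.EllipticCurves.Kato2004.EulerSystemValues
open Summit.BirchSwinnertonDyer.BirchSwinnertonDyer.Theses.DerivedKatoValuationDoor
  (CrisAtDoorPrimes PointsTwo IntegralH1RankLeTwoOfAnalyticRankTwo)

/-! ## §1 `LocPOfPoint`, proved: a rational point of infinite order gives ε at every prime -/

section Point

variable (W : WeierstrassCurve ℚ) [W.IsElliptic] [W.IsGloballyMinimal] (p : ℕ) [Fact p.Prime]
  [ContinuousSMul ℤ_[p] (W.tateModule p)]

/-- **ε from one rational point of infinite order (`LocPOfPoint`, PROVED; every globally minimal `W/ℚ`, EVERY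
prime `p`).**  If `P ∈ E(ℚ)` has infinite order, some integral class `x ∈ H¹(ℤ[1/p], T_pE)` has a Kummer
localisation of non-zero logarithm: `x = p^c • κ_∞(P)` (the tree's `T_p`-adic Kummer class made integral by the
Tamagawa exponent, `GlobalKummer.exists_pow_smul_kummerTate_mem_integralH1_hasLocPKummerLog`) with
`t = log_ω(p^c • P) ≠ 0`, because `log_ω` kills only torsion on `E(ℚ_p)` (`isOfFinAddOrder_of_padicLogLocal_eq_zero`)
and `E(ℚ) → E(ℚ_p)` is an injective homomorphism (`Affine.Point.map_injective`), so `p^c • P` of infinite order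
stays of infinite order locally. [cite: BlochKato1990, Ex. 3.11] [cite: Kato2004Asterisque, §14.1 (p. 235)]
[cite: SilvermanAEC2009, IV.6.4 and VII.6.3] -/
theorem exists_integral_hasLocPKummerLog_ne_zero_of_not_isOfFinAddOrder {P : W.toAffine.Point}
    (hP : ¬ IsOfFinAddOrder P) :
    ∃ (x : H1 (tateRep W p) ⊤) (t : ℚ_[p]),
      x ∈ integralH1 (tateRep W p) p ⊤ ∧ t ≠ 0 ∧ HasLocPKummerLog W p x t := by
  obtain ⟨c, κ, -, hκ⟩ :=
    Summit.BirchSwinnertonDyer.Rank1Residual.Additive.GlobalKummer.exists_pow_smul_kummerTate_mem_integralH1_hasLocPKummerLog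
      W p
  obtain ⟨hint, -, hlog⟩ := hκ P
  refine ⟨p ^ c • κ P, _, hint, ?_, hlog⟩
  intro h0
  have hloc :=
    CongruentShaFreeCutKatoKummerLogTorsion.isOfFinAddOrder_of_padicLogLocal_eq_zero W p h0
  have hpc : IsOfFinAddOrder (p ^ c • P) :=
    ((WeierstrassCurve.Affine.Point.map_injective
      (W' := W.toAffine) (f := Algebra.ofId ℚ ℚ_[p])).isOfFinAddOrder_iff).mp hloc
  exact hP (hpc.of_nsmul (pow_ne_zero c (Fact.out : p.Prime).ne_zero))

/-- **ε from `rank E(ℚ) ≠ 0`** (every globally minimal `W/ℚ`, every prime `p`): a curve of positive rank has a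
rational point of infinite order (`exists_not_isOfFinAddOrder_of_mordellWeilRank_ne_zero`, AEC VIII.6.7), whence
§1. [cite: BlochKato1990, Ex. 3.11] [cite: SilvermanAEC2009, VIII.6.7 and IV.6.4] -/
theorem exists_integral_hasLocPKummerLog_ne_zero_of_mordellWeilRank_ne_zero (hr : W.mordellWeilRank ≠ 0) :
    ∃ (x : H1 (tateRep W p) ⊤) (t : ℚ_[p]),
      x ∈ integralH1 (tateRep W p) p ⊤ ∧ t ≠ 0 ∧ HasLocPKummerLog W p x t := by
  obtain ⟨P, hP⟩ := W.exists_not_isOfFinAddOrder_of_mordellWeilRank_ne_zero hr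
  exact exists_integral_hasLocPKummerLog_ne_zero_of_not_isOfFinAddOrder W p hP

/-- **With a rational point of infinite order EVERY integral class is Kummer at `p`** (the first assertion of
Perrin-Riou's Lemme 2.3.9 off the phantom cell, unconditionally): §1 feeds the tree's Kurihara–Pollack line
`LocPKummer.hasLocPKummerLog_of_exists_log_ne_zero_of_mem_integralH1`. [cite: PerrinRiou1993AIF, Lemme 2.3.9 (p. 967)]
[cite: KuriharaPollack2007, §1.4 Lemma 1.4] -/
theorem forall_hasLocPKummerLog_of_mordellWeilRank_ne_zero (hr : W.mordellWeilRank ≠ 0)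
    {y : H1 (tateRep W p) ⊤} (hy : y ∈ integralH1 (tateRep W p) p ⊤) :
    ∃ t : ℚ_[p], HasLocPKummerLog W p y t :=
  Summit.BirchSwinnertonDyer.Rank1Residual.Additive.LocPKummer.hasLocPKummerLog_of_exists_log_ne_zero_of_mem_integralH1
    W p (exists_integral_hasLocPKummerLog_ne_zero_of_mordellWeilRank_ne_zero W p hr) hy

end Point

/-! ## §2 The rider ε from positive rank at analytic rank two; from the residual `PointsTwo` -/

/-- **`CrisAtDoorPrimes` ⟸ «`a = 2 ⇒ 1 ≤ rank E(ℚ)`»** (the door triple is not used: ε holds at every prime of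
a positive-rank curve, §1).  The hypothesis is the weakest point statement implying the rider; it is open
(no point-producing mechanism at analytic rank two), and strictly weaker than `PointsTwo`.
[cite: BlochKato1990, Ex. 3.11] [cite: PerrinRiou1993AIF, 2.3.8 b) (p. 966)] -/
theorem crisAtDoorPrimes_of_forall_rankPos
    (hpos : ∀ (W : WeierstrassCurve ℚ) [W.IsElliptic], W.analyticRank = 2 → 1 ≤ W.mordellWeilRank) :
    CrisAtDoorPrimes := by
  intro W _ _ p _ _ ha _hdoor
  exact exists_integral_hasLocPKummerLog_ne_zero_of_mordellWeilRank_ne_zero W p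
    (by have := hpos W ha; omega)

/-- **`PointsTwo → CrisAtDoorPrimes`: the rider ε (stmt-BirchSwinnertonDyer-23148) is implied by the route's
own declared residual `PointsTwo` (stmt-BirchSwinnertonDyer-23026, a binder of `closes`).**  So, INSIDE route
`DerivedKatoValuationDoor`, ε is not additional open content. [cite: BlochKato1990, Ex. 3.11]
[cite: PerrinRiou1993AIF, 2.3.8 b) (p. 966)] -/
theorem crisAtDoorPrimes_of_pointsTwo (hPts : PointsTwo) : CrisAtDoorPrimes :=
  crisAtDoorPrimes_of_forall_rankPos fun W _ ha ↦ by have := hPts W ha; omega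

/-! ## §3 The crux S2 by name from {dictionary (print), N1∣_door (open), `PointsTwo` (residual)} -/

/-- **S2 `IntegralH1RankLeTwoOfAnalyticRankTwo` BY NAME from Perrin-Riou's dictionary fact, N1∣_door and the
route's residual `PointsTwo`** (INPUTS' G101 `integralH1RankLeTwo_of_lemme239_of_selCap_of_crisAt` with ε
supplied by §2).  CONDITIONAL reduction: inside the route the conjecture-grade content of S2 beyond the printed
dictionary is N1∣_door alone. [cite: PerrinRiou1993AIF, Lemme 2.3.9 (p. 967)] [cite: KuriharaPollack2007, §1.4 Lemma 1.4] -/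
theorem integralH1RankLeTwoOfAnalyticRankTwo_of_lemme239_of_selCap_of_pointsTwo
    (hPR : PerrinRiou1993.lemme239_rank_integralH1_eq_selmerCorank)
    (hSel : ∀ (W : WeierstrassCurve ℚ) [W.IsElliptic] [W.IsGloballyMinimal] (p : ℕ) [Fact p.Prime],
      W.analyticRank = 2 →
        (5 ≤ p ∧ Literature.NumberTheory.EllipticCurves.IsOrdinaryAt W p ∧ W.HasSurjectiveModNGaloisRep p) →
          W.selmerCorank p ≤ 2)
    (hPts : PointsTwo) : IntegralH1RankLeTwoOfAnalyticRankTwo := by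
  intro W _ _ p _ _ ha hdoor
  exact integralH1RankLeTwo_of_lemme239_of_selCap_of_crisAt hPR hSel (crisAtDoorPrimes_of_pointsTwo hPts)
    W p ha hdoor

/-- **S2 BY NAME from the dictionary fact, N1∣_door and «`a = 2 ⇒ 1 ≤ rank E(ℚ)`»** (the weakest point input).
CONDITIONAL reduction. [cite: PerrinRiou1993AIF, Lemme 2.3.9 (p. 967)] -/
theorem integralH1RankLeTwoOfAnalyticRankTwo_of_lemme239_of_selCap_of_forall_rankPos
    (hPR : PerrinRiou1993.lemme239_rank_integralH1_eq_selmerCorank)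
    (hSel : ∀ (W : WeierstrassCurve ℚ) [W.IsElliptic] [W.IsGloballyMinimal] (p : ℕ) [Fact p.Prime],
      W.analyticRank = 2 →
        (5 ≤ p ∧ Literature.NumberTheory.EllipticCurves.IsOrdinaryAt W p ∧ W.HasSurjectiveModNGaloisRep p) →
          W.selmerCorank p ≤ 2)
    (hpos : ∀ (W : WeierstrassCurve ℚ) [W.IsElliptic], W.analyticRank = 2 → 1 ≤ W.mordellWeilRank) :
    IntegralH1RankLeTwoOfAnalyticRankTwo := by
  intro W _ _ p _ _ ha hdoor
  exact integralH1RankLeTwo_of_lemme239_of_selCap_of_crisAt hPR hSel (crisAtDoorPrimes_of_forall_rankPos hpos)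
    W p ha hdoor

end Summit.BirchSwinnertonDyer.BirchSwinnertonDyer.Theorems.DerivedKatoValuationDoor

end
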